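import Summits.FinalStateConjecture.FinalStateConjecture.Theses.SwallowTheDatum
import Summits.FinalStateConjecture.FinalStateConjecture.Theorems.KerrShieldedDataExist.Negative.BentHeight

/-!
# Sketch — crux-ideate round 2, ideator 5, crux `KerrShieldedSettles` (stmt-FinalStateConjecture-10054)

First lemmas of the three idea cards, stated over existing declarations (sorried; they only have
to elaborate).  Namespace as required by the crux protocol.
-/

noncomputable section

open Literature.Geometry.Lorentzian
open Summit.FinalStateConjecture.FinalStateConjecture.Theorems.KerrShieldedDataExist.Negative
  (bentHeight bentSlope blHeight)

namespace Summit.FinalStateConjecture.FinalStateConjecture.Cruxes.KerrShieldedSettles.Ideator5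

/-! ## Card `speed-limit-energy-floor` -/

/-- SPEED LIMIT (light cones of `g = η + 2Hℓ⊗ℓ` lie inside those of `η`, `H ≥ 0`): a future causal
vector has Euclidean spatial part bounded by its `t*`-component. -/
theorem speedLimit {M a : ℝ} (hM : 0 ≤ M) {x : E4} (hx : 0 < Kerr.radius a x) {v : E4}
    (hv : Kerr.bilin M a x v v ≤ 0) (hv0 : 0 < v 0) :
    E4.spatialNorm v ≤ v 0 := by
  sorry

/-- ENERGY FLOOR: with `E := −g(∂_{t*}, v)` the Killing energy of a future causal vector `v`,
`E ≤ v⁰` everywhere on `{r > 0}` and `v⁰ ≤ 2E` on the far zone `{r ≥ 8M}` (where `H ≤ M/r ≤ 1/8`). -/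
theorem energyFloor {M a : ℝ} (hM : 0 ≤ M) {x : E4} (hx : 0 < Kerr.radius a x) {v : E4}
    (hv : Kerr.bilin M a x v v ≤ 0) (hv0 : 0 < v 0) :
    -Kerr.bilin M a x (E4.basisVector 0) v ≤ v 0 ∧
      (8 * M ≤ Kerr.radius a x → v 0 ≤ 2 * (-Kerr.bilin M a x (E4.basisVector 0) v)) := by
  sorry

/-- INNER CONE: on `{r ≥ 8M/δ}` the straight coordinate directions of Euclidean speed `≤ 1 − δ` are
future timelike, so `J⁺`-membership in the far zone is decided by flat geometry with room `δ`. -/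
theorem innerCone {M a δ : ℝ} (hM : 0 ≤ M) (hδ : 0 < δ) (hδ1 : δ ≤ 1) {x : E4}
    (hx0 : 0 < Kerr.radius a x) (hx : 8 * M ≤ δ * Kerr.radius a x) {v : E4} (hv0 : v 0 = 1)
    (hv : E4.spatialNorm v ≤ 1 - δ) :
    Kerr.bilin M a x v v < 0 := by
  sorry

/-! ## Card `three-clocks-pinched-development` -/

/-- THE THIRD CLOCK: on the black-hole zone `r₋ < r < r₊` the Kerr–Schild radius strictly decreases
along every future causal vector (`dr` is a timelike covector there, `Σ·g⁻¹(dr,dr) = Δ < 0`, and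
`g⁻¹(dt*, dr) = 2H > 0` fixes the sign). -/
theorem radius_strictAnti_hole {M a : ℝ} (hM : 0 ≤ M) {x : E4}
    (h₁ : Kerr.rMinus M a < Kerr.radius a x) (h₂ : Kerr.radius a x < Kerr.rPlus M a)
    (hx0 : 0 < Kerr.radius a x) {v : E4} (hv : Kerr.bilin M a x v v ≤ 0) (hv0 : 0 < v 0) :
    fderiv ℝ (Kerr.radius a) x v < 0 := by
  sorry

/-- … and weakly on the horizon `r = r₊` (no future causal vector points outward), which is the
covector form of "past-directed causal curves from the exterior never enter the hole". -/
theorem radius_anti_horizon {M a : ℝ} (hM : 0 ≤ M) {x : E4}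
    (h : Kerr.radius a x = Kerr.rPlus M a) (hx0 : 0 < Kerr.radius a x) {v : E4}
    (hv : Kerr.bilin M a x v v ≤ 0) (hv0 : 0 < v 0) :
    fderiv ℝ (Kerr.radius a) x v ≤ 0 := by
  sorry

/-- THE SECOND CLOCK with a pinch: for any `C¹` profile `β` with `0 ≤ β' ≤ 1/(2c₁)`,
`c₁² = 1 + a²/r₁²`, the function `u_β = t* − T(r) + β(r)` is a time function on `{r > r₁}`:
`du_β(v) > 0` for every future causal `v` (convexity of the conormal form in the slope between the
certified slope `T′` and `T′ − β′`). Stated through the derivative of `r ↦ T(r) − β(r)`. -/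
theorem pinchedClock_timeFunction {M a r₁ : ℝ} (hM : 0 ≤ M) (ha : |a| < M)
    (h₁ : Kerr.rMinus M a < r₁) (β : ℝ → ℝ) (hβ : Differentiable ℝ β)
    (hβ' : ∀ r, 0 ≤ deriv β r ∧ deriv β r * Real.sqrt (1 + a ^ 2 / r₁ ^ 2) ≤ 1 / 2)
    {x : E4} (hx : r₁ < Kerr.radius a x) (hx0 : 0 < Kerr.radius a x)
    {v : E4} (hv : Kerr.bilin M a x v v ≤ 0) (hv0 : 0 < v 0) :
    0 < v 0 - (bentSlope M a (Kerr.radius a x) - deriv β (Kerr.radius a x)) *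
      fderiv ℝ (Kerr.radius a) x v := by
  sorry

/-! ## Card `zero-mass-scaling-deviation` -/

/-- SCALE COVARIANCE of the Kerr–Schild family: radius, scalar `H`, metric components and the bent
slope are jointly homogeneous of degree `1, 0, 0, 0` in `(x; M, a)`. -/
theorem radius_scale {a c : ℝ} (hc : 0 < c) (x : E4) :
    Kerr.radius (c * a) (c • x) = c * Kerr.radius a x := by
  sorry

theorem scalarH_scale {M a c : ℝ} (hc : 0 < c) (x : E4) :
    Kerr.scalarH (c * M) (c * a) (c • x) = Kerr.scalarH M a x := by
  sorry

theorem bilin_scale {M a c : ℝ} (hc : 0 < c) (x : E4) :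
    Kerr.bilin (c * M) (c * a) (c • x) = Kerr.bilin M a x := by
  sorry

theorem bentSlope_scale {M a c : ℝ} (hc : 0 < c) (ha : |a| < M) {r : ℝ}
    (hr : Kerr.rPlus M a < r) :
    bentSlope (c * M) (c * a) (c * r) = bentSlope M a r := by
  sorry

/-- ZERO-MASS CONTINUITY (the only "estimate"): on the unit annulus the far-zone slope
`2mr/(r² − 2mr + α²)` and the scalar `H` are continuous in `(m, α, x)` down to `m = 0`, where they
vanish; e.g. the `C⁰` instance: -/
theorem scalarH_tendsto_zero_mass (x : E4) (hx : 1 ≤ Kerr.radius 0 x) :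
    Filter.Tendsto (fun p : ℝ × ℝ => Kerr.scalarH p.1 p.2 x) (nhds (0, 0)) (nhds 0) := by
  sorry

end Summit.FinalStateConjecture.FinalStateConjecture.Cruxes.KerrShieldedSettles.Ideator5

end
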